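import Literature.NumberTheory.ComplexMultiplication.CMAlgebraTorusReflexFieldIntrinsic
import Literature.NumberTheory.ComplexMultiplication.CMAlgebraTorusCentralizer
import Literature.Geometry.Kaehler.ComplexTorusHodgeGroupCommutative
import HarnessLib

/-!
# «Let `E₀` be the centre of `End⁰(A)`. There exists a CM-type `Φ₀` on `E₀` … `(E, Φ)` extends `(E₀, Φ₀)`»: the CM type
# of the CENTRE of `End_ℚ(X)` of a complex torus with multiplication by a CM-algebra, and the reflex field read on it
# (Milne, *Complex Multiplication*, Ch. I §3 p. 29) — torus level

Topic `Literature/NumberTheory/ComplexMultiplication`, namespace `Literature.NumberTheory.ComplexMultiplication`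
(theorems under `IsCMAlgTorusRat`); lane `lit-hodgefound` (Track 2 foundations library), Layer A3, skeleton seat
`lit-hodgefound-skel-3`, generation 54, row A3-G138 FILE 2 — the sequel of `CMAlgebraTorusReflexFieldIntrinsic` (FILE 1:
the reflex field of `(X, ρ)` is `ℚ(entries of i·J_ℂ)`, joint eigenvectors of `ρ(Y) ⊗ 1` on `V_ℂ`, the dichotomy
`W_φ ⊆ V^{-1,0}` / `W_φ ⊆ V^{0,-1}`).  THEOREMS ONLY: no definition, no instance, no notation, no named fact (D-0026,
net debt `0`); Milne's `Φ₀` is produced EXISTENTIALLY together with its intrinsic characterisation (the characters of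
the centre occurring in `V^{-1,0} = Lie(X)`), which determines it.

Inputs, BY NAME: `CMAlgebraTorusCentralizer` (p19: `IsCMAlgTorusRat.center_endAlgRat_le` — the centre of `End_ℚ(X)`
lies in `ρ(Y)`; `mem_range_of_forall_comm`), `Geometry/Kaehler/ComplexTorusHodgeGroupCommutative`
(`jMatrix_mem_span_centralizer_endAlgRat`: `J` is a real combination of rational matrices commuting with `End_ℚ(X)`),
`CMTypeOnSubalgebra` (p27: `cmTypeOnExtend`, `eq_cmTypeOnExtend_of_restrictSet_subset`), `CMAlgebraReflexField`
(Prop. 1.18 (c) `reflexFieldOn_cmTypeOnExtend`), FILE 1, and Mathlib's lying-over theorem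
`Ideal.exists_ideal_over_prime_of_isIntegral` with `IsAlgClosed.surjective_restrictDomain_of_isAlgebraic` for the
algebra lemma of §0.

## Source, verbatim

J. S. Milne, *Complex Multiplication* (course notes, version 2020; bib `MilneCM2006`; fetched text
`paper:url-8ccc30e4daab`), Ch. I §3, p. 29 (p0029): «**The reflex field of an abelian variety with complex
multiplication.** Let `E₀` be the centre of `End⁰(A)`. There exists a CM-type `Φ₀` on `E₀` with the following property:
suppose `A` is of CM-type `(E, Φ)` (relative to `E → End⁰(A)`); then `(E, Φ)` extends `(E₀, Φ₀)`. Therefore, the reflex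
field of `(E₀, Φ₀)` equals the reflex field of any such `(E, Φ)` (1.18c). We call it the reflex field of `A`.»  With
Ch. I §1 p. 11 (after Def. 1.8): «Let `E₀` be a CM-algebra, `E` a CM-algebra containing `E₀`, and `Φ₀` a CM type on
`E₀`. Then `Φ = {φ : E → ℚ^al | φ|E₀ ∈ Φ₀}` is a CM type on `E`; we say that `(E, Φ)` extends `(E₀, Φ₀)`» (the tree's
`cmTypeOnExtend`), §3.11 p. 29 «let `Φ` be the set of homomorphisms `E → ℂ` occurring in the representation of `E` on
`Tgt₀(A)`», and Prop. 1.18 (c) «The reflex field of any extension `(E₁, Φ₁)` of `(E, Φ)` equals that of `(E, Φ)`».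
The same reading of a CM type on the centre, for ONE field and a polarised torus, is G. Shimura, *Abelian Varieties
with Complex Multiplication and Modular Functions* (1998) §5.2 pp. 39–40 («the restriction of `φ₁, …, φₙ` to `K`
[the centre] yields exactly `f/2` isomorphisms `ψ₁, …, ψ_{f/2}` of `K` into `ℂ` […] there are no two isomorphisms
among [them] which are complex conjugate of each other») — in the tree as `Geometry/Kaehler/
ComplexTorusCMTypeCenterRestriction` (p11, via Zarhin's multiplicities); the present file needs no polarisation.

## What is formalised (`h : IsCMAlgTorusRat P ρ`, `Y = Πᵢ Lᵢ`, `V⁺ = V^{-1,0} = hodgeFiltrationConj (jMatrix P)`,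
## `Φ = ⊔ᵢ Φᵢ` the CM type of `(X, ρ)`, `E* = reflexFieldOn Φ`)

THE CENTRE `E₀`. The statements of §§1–5 are made for a commutative `ℚ`-algebra `Z` together with an INJECTIVE
`ℚ`-algebra map `m : Z → End_ℚ(X)` WHOSE RANGE IS THE CENTRE, `hZ : m.range = Subalgebra.center ℚ (endAlgRat P)`
(so `(Z, m)` is the centre `E₀` of `End_ℚ(X)` up to the isomorphism `m`; a character `ψ : Z → ℂ` OCCURS in `V^{-1,0}`
when some non-zero `v ∈ V^{-1,0}` has `(m(z) ⊗ 1) v = ψ(z) v` for all `z`); §6 is the tautological choice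
`Z = Subalgebra.center ℚ (endAlgRat P)`, `m` = the inclusion — the statements as printed.  (Reason for the detour:
Mathlib equips `↥(Subalgebra.center ℚ A)` with its `CommRing` structure through `Subring.center`, and keeping the
centre abstract keeps every statement on the generic `CommRing` carrier of the tree's `Emb`/`CMTypeOn`/`reflexFieldOn`.)

* §0 (algebra) `exists_algHom_pi_comp_eq_of_injective`: every `ℚ`-algebra homomorphism `Z′ → ℂ` of a subalgebra
  `Z′ ↪ Πⱼ Lⱼ` of a finite product of number fields EXTENDS to `Πⱼ Lⱼ` (lying over for the finite extension
  `Z′ ⊆ Πⱼ Lⱼ`, the primes of `Πⱼ Lⱼ` being the kernels of the projections, then extension of field embeddings into the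
  algebraically closed `ℂ`) — the standing hypothesis «restriction of embeddings is onto» of the tree's Prop. 1.18 (c).
* §1 «relative to `E₀ → E`»: `exists_algHom_of_range_eq_center` — the centre embeds in `Y` compatibly with `ρ`
  (`ρ ∘ i = m`, from `center_endAlgRat_le`); such an `i` is injective (`injective_of_comp_eq`) and every embedding of
  `Z` extends along it (`exists_comp_eq`).
* §2 the characters of the centre on `V_ℂ`: restriction of joint `Y`-eigenvectors, conjugation, and the KEY LEMMA
  `exists_forall_jMatrix_mulVec_eq_smul` — `J ⊗ 1` acts on every joint `Z`-eigenvector of type `ψ` by ONE scalar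
  `c(ψ)` (because `J ∈ E₀ ⊗ ℝ`); hence a character `ψ` occurring in `V^{-1,0}` does not occur in `V^{0,-1}`
  (`eq_zero_of_mem_hodgeFiltration_of_occurs`), its conjugate does not occur in `V^{-1,0}`
  (`not_occurs_conjEmb_of_occurs`), while every `ψ` or its conjugate occurs in `V^{-1,0}` (`occurs_or_occurs_conjEmb`).
* §3 **«There exists a CM-type `Φ₀` on `E₀`»**: `exists_cmTypeOn_of_range_eq_center` — a CM type `Φ₀` on `Z` whose
  members are EXACTLY the characters occurring in `V^{-1,0}` (§3.11's «the set of homomorphisms occurring in the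
  representation on `Tgt₀(A)`», applied to `E₀`), unique with this property (`cmTypeOn_unique_of_occurs`) — the
  characterisation mentions `X` and the centre only, not `(Y, ρ)`.
* §4 **«then `(E, Φ)` extends `(E₀, Φ₀)`»**: `cmTypeOnPi_eq_cmTypeOnExtend` — `Φ = Φ₀^Y` along `i`
  (`cmTypeOnExtend`); membership form `mem_cmType_iff_comp_mem` (`φ ∈ Φ ⟺ φ|E₀ ∈ Φ₀`).
* §5 **«Therefore, the reflex field of `(E₀, Φ₀)` equals the reflex field of any such `(E, Φ)` (1.18c)»**:
  `reflexFieldOn_eq_reflexFieldOn_of_range_eq_center`, and with FILE 1 `reflexFieldOn_eq_adjoin_entries_of_range_eq_center`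
  (`(E₀, Φ₀)* = ℚ(entries of i·J_ℂ)`).
* §6 the same for `E₀ = Subalgebra.center ℚ (endAlgRat P)` itself: `exists_algHom_center`, `exists_cmTypeOn_center`,
  `reflexFieldOn_eq_reflexFieldOn_center` («We call it the reflex field of `A`»), `reflexFieldOn_center_eq_adjoin_entries`.
* §7 (§3.11 verbatim) `mem_cmTypeOnPi_iff_occurs`: «`Φ` = the set of homomorphisms `E → ℂ` occurring in the representation
  of `E` on `Tgt₀(A)`» — `φ ∈ Φ ⟺ φ` occurs in `V^{-1,0}`; hence `eq_cmTypeOnPi_of_occurs` (a CM type of `Y` characterised by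
  occurrence through `ρ` IS `Φ`), and `range_toEnd_eq_center`: when `End_ℚ(X)` is commutative (Remark 3.5: e.g. `X` simple,
  `End⁰` a field of degree `2 dim`) `ρ(Y)` is the centre, so `(Y, ρ)` itself is `(E₀, Φ₀)`.

## References

* [MilneCM2006] J. S. Milne, *Complex Multiplication* (course notes, 2006/2020), Ch. I §1 p. 11 (extension of CM types),
  Prop. 1.18 (c); §3 p. 29 «The reflex field of an abelian variety with complex multiplication», §3.11.
* [Shimura1998] G. Shimura, *Abelian Varieties with Complex Multiplication and Modular Functions*, Princeton 1998, §5.2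
  pp. 39–40 (the type read on the centre), §18.7 pp. 129–130.
* [Lange2023AbelianVarietiesComplex] H. Lange, *Abelian Varieties over the Complex Numbers* (2023), §7.2.3 Prop. 7.2.6
  (proof: `J ∈ T ⊗ ℝ`) — used through the tree.
-/

noncomputable section

open scoped Classical Matrix Pointwise
open Module Matrix NumberField Complex

namespace Literature.NumberTheory.ComplexMultiplication

open Literature.AlgebraicGeometry.GaoUllmo2025
open Literature.AlgebraicGeometry.Motives (CMType)
open Literature.Geometry.Kaehler
open Literature.Geometry.Kaehler.ComplexTorus

/-! ## §0 Algebra: embeddings of a subalgebra of a finite product of number fields extend -/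

section Algebra

variable {t : Type} [Fintype t] [DecidableEq t] {L : t → Type} [∀ j, Field (L j)]

omit [DecidableEq t] in
/-- A prime ideal of a finite product of fields is the kernel of one of the projections (the idempotents `e_j`
multiply to `0` pairwise and sum to `1`). [folklore] -/
private theorem exists_eq_ker_evalRingHom_of_isPrime₅₄ (Q : Ideal (Π j, L j)) [hQ : Q.IsPrime] :
    ∃ j₀, Q = RingHom.ker (Pi.evalRingHom L j₀) := by
  classical
  -- some idempotent `e_{j₀}` is not in `Q`
  have h1 : (1 : Π j, L j) ∉ Q := (Ideal.ne_top_iff_one Q).1 hQ.ne_top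
  have hsum : ∑ j, (Pi.single j 1 : Π j, L j) = 1 := by
    ext k
    rw [Finset.sum_apply, Finset.sum_eq_single k (fun j _ hjk => by rw [Pi.single_eq_of_ne' hjk])
      (fun hk => absurd (Finset.mem_univ k) hk), Pi.single_eq_same, Pi.one_apply]
  obtain ⟨j₀, hj₀⟩ : ∃ j₀, (Pi.single j₀ 1 : Π j, L j) ∉ Q := by
    by_contra hall
    push Not at hall
    exact h1 (hsum ▸ Q.sum_mem fun j _ => hall j)
  refine ⟨j₀, le_antisymm (fun y hy => ?_) (fun y hy => ?_)⟩
  · -- `y ∈ Q` has `y j₀ = 0`, else `e_{j₀} = (y_{j₀}⁻¹ e_{j₀}) y ∈ Q`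
    rw [RingHom.mem_ker, Pi.evalRingHom_apply]
    by_contra hy0
    apply hj₀
    have : (Pi.single j₀ 1 : Π j, L j) = Pi.single j₀ ((y j₀)⁻¹) * y := by
      ext k
      rcases eq_or_ne k j₀ with rfl | hk
      · rw [Pi.mul_apply, Pi.single_eq_same, Pi.single_eq_same, inv_mul_cancel₀ hy0]
      · rw [Pi.mul_apply, Pi.single_eq_of_ne hk, Pi.single_eq_of_ne hk, zero_mul]
    rw [this]
    exact Q.mul_mem_left _ hy
  · -- `y j₀ = 0`: `y = Σ_{k ≠ j₀} y e_k` with `e_k ∈ Q` (`e_{j₀} e_k = 0 ∈ Q`, `Q` prime)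
    rw [RingHom.mem_ker, Pi.evalRingHom_apply] at hy
    have hek : ∀ k, k ≠ j₀ → (Pi.single k 1 : Π j, L j) ∈ Q := fun k hk => by
      have h0 : (Pi.single j₀ 1 : Π j, L j) * Pi.single k 1 = 0 := by
        ext l
        rw [Pi.mul_apply, Pi.zero_apply]
        rcases eq_or_ne l j₀ with rfl | hl
        · rw [Pi.single_eq_of_ne (Ne.symm hk), mul_zero]
        · rw [Pi.single_eq_of_ne hl, zero_mul]
      exact (hQ.mem_or_mem (h0 ▸ Q.zero_mem : (Pi.single j₀ 1 : Π j, L j) * Pi.single k 1 ∈ Q)).resolve_left hj₀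
    have hy' : y = ∑ k, y * Pi.single k 1 := by
      rw [← Finset.mul_sum, hsum, mul_one]
    rw [hy']
    refine Q.sum_mem fun k _ => ?_
    rcases eq_or_ne k j₀ with rfl | hk
    · have : y * (Pi.single k 1 : Π j, L j) = 0 := by
        ext l
        rw [Pi.mul_apply, Pi.zero_apply]
        rcases eq_or_ne l k with rfl | hl
        · rw [hy, zero_mul]
        · rw [Pi.single_eq_of_ne hl, mul_zero]
      rw [this]
      exact Q.zero_mem
    · exact Q.mul_mem_left _ (hek k hk)

variable [∀ j, NumberField (L j)]

omit [DecidableEq t] in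
/-- **Embeddings extend along a subalgebra of a finite product of number fields**: for an INJECTIVE `ℚ`-algebra map
`i : Z′ → Πⱼ Lⱼ` and any `ψ : Z′ → ℂ` there is `φ : Πⱼ Lⱼ → ℂ` with `φ ∘ i = ψ` — the hypothesis «restriction
`Hom(E, ℂ) → Hom(E₀, ℂ)` onto» of the tree's Prop. 1.18 (c) (`reflexFieldOn_cmTypeOnExtend`), here for the centre
`E₀ ⊆ E`.  Proof: `Πⱼ Lⱼ` is integral over `Z′`, so a prime `Q` of `Πⱼ Lⱼ` lies over `ker ψ` (lying over); `Q` is the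
kernel of a projection `pr_{j₀}`, so `ker ψ = ker(pr_{j₀} ∘ i)` is maximal (`Z′` is artinian) with residue FIELD `κ`
embedded in `L_{j₀}` and in `ℂ`; the embedding `κ → ℂ` extends to `L_{j₀}` (`ℂ` algebraically closed).
[cite: MilneCM2006, Ch. I §1 p. 11 (after Def. 1.8: «`E` a CM-algebra containing `E₀`», every `φ|E₀`)] -/
theorem exists_algHom_pi_comp_eq_of_injective {Z : Type} [CommRing Z] [Algebra ℚ Z] (i : Z →ₐ[ℚ] (Π j, L j))
    (hi : Function.Injective i) (ψ : Z →ₐ[ℚ] ℂ) : ∃ φ : (Π j, L j) →ₐ[ℚ] ℂ, φ.comp i = ψ := by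
  classical
  -- `Πⱼ Lⱼ` as a finite (hence integral) `Z`-algebra through `i`
  letI : Algebra Z (Π j, L j) := i.toRingHom.toAlgebra
  have halg : ∀ z, algebraMap Z (Π j, L j) z = i z := fun _ => rfl
  haveI : IsScalarTower ℚ Z (Π j, L j) :=
    IsScalarTower.of_algebraMap_eq fun q => by rw [halg, AlgHom.commutes]
  haveI : Module.Finite Z (Π j, L j) := Module.Finite.of_restrictScalars_finite ℚ Z (Π j, L j)
  haveI : Algebra.IsIntegral Z (Π j, L j) := Algebra.IsIntegral.of_finite Z _
  haveI : Module.Finite ℚ Z := Module.Finite.of_injective i.toLinearMap hi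
  -- lying over `𝔭 = ker ψ`
  set 𝔭 : Ideal Z := RingHom.ker ψ with h𝔭
  haveI : 𝔭.IsPrime := RingHom.ker_isPrime _
  obtain ⟨Q, -, hQ, hQcomap⟩ := Ideal.exists_ideal_over_prime_of_isIntegral 𝔭 (⊥ : Ideal (Π j, L j))
    (fun z hz => by
      rw [Ideal.mem_comap, Ideal.mem_bot, halg, ← map_zero i] at hz
      rw [hi hz]
      exact 𝔭.zero_mem)
  haveI := hQ
  obtain ⟨j₀, hQj⟩ := exists_eq_ker_evalRingHom_of_isPrime₅₄ Q
  -- `θ = pr_{j₀} ∘ i` has the same kernel as `ψ`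
  set θ : Z →ₐ[ℚ] L j₀ := (Pi.evalAlgHom ℚ L j₀).comp i with hθ
  have hθapp : ∀ z, θ z = i z j₀ := fun _ => rfl
  have hker : ∀ z, z ∈ 𝔭 ↔ θ z = 0 := fun z => by
    have h1 := (Ideal.ext_iff.1 hQcomap) z
    rw [Ideal.mem_comap, hQj, RingHom.mem_ker, Pi.evalRingHom_apply, halg] at h1
    rw [hθapp, h1]
  -- `𝔭` is maximal; `κ = Z ⧸ 𝔭` is a field, embedded in `L_{j₀}` by `θ` and in `ℂ` by `ψ`
  haveI : IsArtinianRing Z := IsArtinianRing.of_finite ℚ Z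
  haveI : 𝔭.IsMaximal := (IsArtinianRing.isPrime_iff_isMaximal 𝔭).1 inferInstance
  letI : Field (Z ⧸ 𝔭) := Ideal.Quotient.field 𝔭
  let θ' : (Z ⧸ 𝔭) →ₐ[ℚ] L j₀ := Ideal.Quotient.liftₐ 𝔭 θ fun z hz => (hker z).1 hz
  let ψ' : (Z ⧸ 𝔭) →ₐ[ℚ] ℂ := Ideal.Quotient.liftₐ 𝔭 ψ fun z hz => hz
  have hθ' : ∀ z, θ' (Ideal.Quotient.mk 𝔭 z) = θ z := fun z => Ideal.Quotient.lift_mk 𝔭 _ _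
  have hψ' : ∀ z, ψ' (Ideal.Quotient.mk 𝔭 z) = ψ z := fun z => Ideal.Quotient.lift_mk 𝔭 _ _
  -- `L_{j₀}` is an algebraic extension of `κ`; extend `ψ'` to it
  letI : Algebra (Z ⧸ 𝔭) (L j₀) := θ'.toRingHom.toAlgebra
  have halg' : ∀ x, algebraMap (Z ⧸ 𝔭) (L j₀) x = θ' x := fun _ => rfl
  haveI : IsScalarTower ℚ (Z ⧸ 𝔭) (L j₀) :=
    IsScalarTower.of_algebraMap_eq fun q => by rw [halg', AlgHom.commutes]
  haveI : Module.Finite (Z ⧸ 𝔭) (L j₀) := Module.Finite.of_restrictScalars_finite ℚ (Z ⧸ 𝔭) (L j₀)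
  haveI : Algebra.IsAlgebraic (Z ⧸ 𝔭) (L j₀) := Algebra.IsAlgebraic.of_finite (Z ⧸ 𝔭) (L j₀)
  obtain ⟨χ, hχ⟩ := IsAlgClosed.surjective_restrictDomain_of_isAlgebraic (K := ℚ) (L := Z ⧸ 𝔭) (E := L j₀)
    (M := ℂ) ψ'
  refine ⟨χ.comp (Pi.evalAlgHom ℚ L j₀), AlgHom.ext fun z => ?_⟩
  have h1 : χ (algebraMap (Z ⧸ 𝔭) (L j₀) (Ideal.Quotient.mk 𝔭 z)) = ψ' (Ideal.Quotient.mk 𝔭 z) := by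
    rw [← hχ]
    rfl
  rw [halg', hθ', hψ'] at h1
  exact h1

end Algebra

namespace IsCMAlgTorusRat

variable {t : Type} {L : t → Type} [∀ i, Field (L i)] [∀ i, NumberField (L i)] [Fintype t] [DecidableEq t]
variable {ι : Type} [Fintype ι] [DecidableEq ι] {E : Type} [NormedAddCommGroup E] [NormedSpace ℂ E]
  {P : (ι → ℝ) ≃L[ℝ] E} {ρ : (Π i, L i) →ₐ[ℚ] Matrix ι ι ℚ}
variable {Z : Type} [CommRing Z] [Algebra ℚ Z] {m : Z →ₐ[ℚ] ↥(endAlgRat P)}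

omit [Fintype ι] in
/-- `End_ℚ(X) ⊆ M_ι(ℚ)` is finite-dimensional over `ℚ`. [folklore] -/
private theorem moduleFinite_endAlgRat₅₄ [Fintype ι] (P : (ι → ℝ) ≃L[ℝ] E) : Module.Finite ℚ ↥(endAlgRat P) :=
  Module.Finite.of_injective (endAlgRat P).val.toLinearMap Subtype.val_injective

omit [Fintype ι] in
/-- A `ℚ`-algebra mapping injectively to `End_ℚ(X)` is finite-dimensional over `ℚ`. [folklore] -/
private theorem moduleFinite_of_injective₅₄ [Fintype ι] {P : (ι → ℝ) ≃L[ℝ] E} {m : Z →ₐ[ℚ] ↥(endAlgRat P)}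
    (hinj : Function.Injective m) : Module.Finite ℚ Z :=
  haveI := moduleFinite_endAlgRat₅₄ P
  Module.Finite.of_injective m.toLinearMap hinj

/-! ## §1 «relative to `E₀ → E`»: the centre of `End_ℚ(X)` inside `Y` -/

/-- **The centre `E₀` of `End_ℚ(X)` embeds in the CM-algebra `Y` compatibly with `ρ`**: for `(Z, m)` the centre
(`m.range = Subalgebra.center ℚ (endAlgRat P)`) there is a `ℚ`-algebra map `i : Z → Y` with `ρ(i(z)) = m(z)` (the centre
lies in `ρ(Y)`, `center_endAlgRat_le`, and `ρ` is injective).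
[cite: MilneCM2006, Ch. I §3 p. 29 («Let `E₀` be the centre of `End⁰(A)` … relative to `E → End⁰(A)`»)] -/
theorem exists_algHom_of_range_eq_center (h : IsCMAlgTorusRat P ρ)
    (hZ : m.range = Subalgebra.center ℚ ↥(endAlgRat P)) :
    ∃ i : Z →ₐ[ℚ] (Π j, L j), ∀ z, ρ (i z) = (m z : Matrix ι ι ℚ) := by
  have hzc : ∀ z, m z ∈ Subalgebra.center ℚ ↥(endAlgRat P) := fun z => by
    rw [← hZ]
    exact m.mem_range_self z
  have hmem : ∀ z, (m z : Matrix ι ι ℚ) ∈ ρ.range := fun z => h.center_endAlgRat_le ⟨m z, hzc z, rfl⟩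
  let e : (Π j, L j) ≃ₐ[ℚ] ρ.range := AlgEquiv.ofInjective ρ h.injective
  let j : Z →ₐ[ℚ] ρ.range := ((endAlgRat P).val.comp m).codRestrict ρ.range fun z => hmem z
  refine ⟨(e.symm : ρ.range →ₐ[ℚ] (Π j, L j)).comp j, fun z => ?_⟩
  have h1 : ((e (e.symm (j z)) : ρ.range) : Matrix ι ι ℚ) = (j z : Matrix ι ι ℚ) := by rw [AlgEquiv.apply_symm_apply]
  rw [AlgEquiv.ofInjective_apply] at h1
  exact h1

omit [Fintype t] [DecidableEq t] in
/-- Such an `i` is injective (`m` is). [cite: MilneCM2006, Ch. I §3 p. 29] -/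
theorem injective_of_comp_eq (hinj : Function.Injective m) (i : Z →ₐ[ℚ] (Π j, L j))
    (hi : ∀ z, ρ (i z) = (m z : Matrix ι ι ℚ)) : Function.Injective i := fun z w hzw =>
  hinj (Subtype.ext (by rw [← hi z, ← hi w, hzw]))

omit [DecidableEq t] in
/-- Every embedding `ψ : E₀ → ℂ` of the centre extends to `Y` along `i` («`φ|E₀`»; §0).
[cite: MilneCM2006, Ch. I §1 p. 11 (after Def. 1.8) and §3 p. 29] -/
theorem exists_comp_eq (hinj : Function.Injective m) (i : Z →ₐ[ℚ] (Π j, L j))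
    (hi : ∀ z, ρ (i z) = (m z : Matrix ι ι ℚ)) (ψ : Emb Z) : ∃ φ : Emb (Π j, L j), φ.comp i = ψ :=
  exists_algHom_pi_comp_eq_of_injective (Z := Z) i (injective_of_comp_eq hinj i hi) ψ

/-! ## §2 The characters of the centre on `V_ℂ`; `J ⊗ 1` acts on each joint `E₀`-eigenspace by a scalar -/

omit [Fintype t] [DecidableEq t] in
/-- A joint `Y`-eigenvector of type `φ` is a joint `E₀`-eigenvector of type `φ ∘ i` (`m(z) = ρ(i z)`).
[cite: MilneCM2006, Ch. I §3 p. 29] -/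
theorem forall_center_mulVec_eq_smul_of_forall (i : Z →ₐ[ℚ] (Π j, L j))
    (hi : ∀ z, ρ (i z) = (m z : Matrix ι ι ℚ)) {φ : Emb (Π j, L j)} {v : ι → ℂ}
    (hv : ∀ a, (ρ a).map (algebraMap ℚ ℂ) *ᵥ v = φ a • v) (z : Z) :
    (m z : Matrix ι ι ℚ).map (algebraMap ℚ ℂ) *ᵥ v = (φ.comp i) z • v := by
  rw [← hi z, hv (i z), AlgHom.comp_apply]

omit [Fintype t] [DecidableEq t] [∀ i, NumberField (L i)] [∀ i, Field (L i)] in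
/-- Complex conjugation carries a joint `E₀`-eigenvector of type `ψ` to one of type `ψ̄` (the matrices are rational).
[cite: MilneCM2006, Ch. I §3 p. 29] -/
theorem mulVec_star_of_forall_center_mulVec_eq_smul {ψ : Emb Z} {v : ι → ℂ}
    (hv : ∀ z, (m z : Matrix ι ι ℚ).map (algebraMap ℚ ℂ) *ᵥ v = ψ z • v) (z : Z) :
    (m z : Matrix ι ι ℚ).map (algebraMap ℚ ℂ) *ᵥ star v = (conjEmb ψ) z • star v := by
  have hreal : (m z : Matrix ι ι ℚ).map (algebraMap ℚ ℂ) =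
      (((m z : Matrix ι ι ℚ).map ((↑) : ℚ → ℝ))).map Complex.ofRealHom := by
    ext a b
    simp [Matrix.map_apply]
  rw [hreal, ← star_map_ofRealHom_mulVec, ← hreal, hv z, star_smul, conjEmb_apply, Complex.star_def]

/-- **`J ∈ E₀ ⊗ ℝ` acts on every joint `E₀`-eigenspace by a scalar**: there is a function `c : Hom(E₀, ℂ) → ℂ` such
that `(J ⊗ 1) v = c(ψ) v` for every joint `E₀`-eigenvector `v` of type `ψ`.  Indeed `J = Σ_k r_k A_k` with real `r_k`
and RATIONAL `A_k` commuting with `End_ℚ(X)` (`jMatrix_mem_span_centralizer_endAlgRat`); for a torus of CM type such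
`A_k` lie in `ρ(Y) ⊆ End_ℚ(X)` (`mem_range_of_forall_comm`), i.e. in the centre, `A_k = m(z_k)`, so
`c(ψ) = Σ_k r_k ψ(z_k)`.
[cite: MilneCM2006, Ch. I §3 p. 29] [cite: Lange2023AbelianVarietiesComplex, §7.2.3 Prop. 7.2.6 (proof: `J ∈ T ⊗ ℝ`)] -/
theorem exists_forall_jMatrix_mulVec_eq_smul (h : IsCMAlgTorusRat P ρ)
    (hZ : m.range = Subalgebra.center ℚ ↥(endAlgRat P)) :
    ∃ c : Emb Z → ℂ, ∀ (ψ : Emb Z) (v : ι → ℂ),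
      (∀ z, (m z : Matrix ι ι ℚ).map (algebraMap ℚ ℂ) *ᵥ v = ψ z • v) →
        (jMatrix P).map Complex.ofRealHom *ᵥ v = c ψ • v := by
  classical
  obtain ⟨n, f, g, hsum⟩ := Submodule.mem_span_set'.1 (jMatrix_mem_span_centralizer_endAlgRat P)
  -- the rational matrices `A_k`, central endomorphisms
  have hg : ∀ k, ∃ A : Matrix ι ι ℚ, A ∈ Subalgebra.centralizer ℚ (endAlgRat P : Set (Matrix ι ι ℚ)) ∧
      A.map ((↑) : ℚ → ℝ) = (g k : Matrix ι ι ℝ) := fun k => by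
    obtain ⟨A, hA, hAeq⟩ := (g k).2
    exact ⟨A, hA, hAeq⟩
  choose A hAc hAg using hg
  have hAE : ∀ k, A k ∈ endAlgRat P := fun k =>
    h.range_le_endAlgRat (h.mem_range_of_forall_comm fun N hN =>
      ((Subalgebra.mem_centralizer_iff ℚ).1 (hAc k) N hN).symm)
  have hAZ : ∀ k, (⟨A k, hAE k⟩ : endAlgRat P) ∈ Subalgebra.center ℚ ↥(endAlgRat P) := fun k => by
    rw [Subalgebra.mem_center_iff]
    intro b
    apply Subtype.ext
    change (b : Matrix ι ι ℚ) * A k = A k * (b : Matrix ι ι ℚ)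
    exact (Subalgebra.mem_centralizer_iff ℚ).1 (hAc k) b b.2
  -- `A_k = m(z_k)`
  have hzA : ∀ k, ∃ z : Z, m z = ⟨A k, hAE k⟩ := fun k => by
    have h1 : (⟨A k, hAE k⟩ : endAlgRat P) ∈ m.range := by
      rw [hZ]
      exact hAZ k
    exact (AlgHom.mem_range m).1 h1
  choose zA hzA using hzA
  have hzA' : ∀ k, (m (zA k) : Matrix ι ι ℚ) = A k := fun k => by rw [hzA k]
  refine ⟨fun ψ => ∑ k, (f k : ℂ) * ψ (zA k), fun ψ v hv => ?_⟩
  -- `J_ℂ = Σ_k f_k · (A_k ⊗ 1)`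
  have hJ : (jMatrix P).map Complex.ofRealHom = ∑ k, (f k : ℂ) • (A k).map (algebraMap ℚ ℂ) := by
    rw [← hsum]
    ext a b
    simp only [Matrix.map_apply, Matrix.sum_apply, Matrix.smul_apply, smul_eq_mul, Complex.ofRealHom_eq_coe,
      Complex.ofReal_sum, Complex.ofReal_mul]
    refine Finset.sum_congr rfl fun k _ => ?_
    rw [← hAg k, Matrix.map_apply]
    simp
  rw [hJ, Matrix.sum_mulVec, Finset.sum_smul]
  refine Finset.sum_congr rfl fun k _ => ?_
  rw [Matrix.smul_mulVec, ← hzA' k, hv (zA k), smul_smul]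

/-- The scalar by which `J ⊗ 1` acts on a NON-ZERO joint `E₀`-eigenvector of `V^{-1,0}` is `i`, on one of `V^{0,-1}` it is
`-i`; hence **a character `ψ` of the centre occurring in `V^{-1,0}` does not occur in `V^{0,-1}`**.
[cite: MilneCM2006, Ch. I §3 p. 29] [cite: Shimura1998, §5.2 pp. 39–40] -/
theorem eq_zero_of_mem_hodgeFiltration_of_occurs (h : IsCMAlgTorusRat P ρ)
    (hZ : m.range = Subalgebra.center ℚ ↥(endAlgRat P)) {ψ : Emb Z} {v w : ι → ℂ}
    (hvm : v ∈ hodgeFiltrationConj (jMatrix P)) (hv0 : v ≠ 0)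
    (hv : ∀ z, (m z : Matrix ι ι ℚ).map (algebraMap ℚ ℂ) *ᵥ v = ψ z • v)
    (hwm : w ∈ hodgeFiltration (jMatrix P))
    (hw : ∀ z, (m z : Matrix ι ι ℚ).map (algebraMap ℚ ℂ) *ᵥ w = ψ z • w) : w = 0 := by
  obtain ⟨c, hc⟩ := h.exists_forall_jMatrix_mulVec_eq_smul hZ
  by_contra hw0
  -- on `v`: `c ψ = i`; on `w`: `c ψ = -i`
  have h1 : c ψ = Complex.I := by
    have := hc ψ v hv
    rw [mem_hodgeFiltrationConj_iff.1 hvm] at this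
    obtain ⟨k, hk⟩ := Function.ne_iff.1 hv0
    have hk' := congrFun this k
    simp only [Pi.smul_apply, smul_eq_mul] at hk'
    exact (mul_right_cancel₀ hk hk').symm
  have h2 : c ψ = -Complex.I := by
    have := hc ψ w hw
    rw [mem_hodgeFiltration_iff.1 hwm] at this
    obtain ⟨k, hk⟩ := Function.ne_iff.1 hw0
    have hk' := congrFun this k
    simp only [Pi.neg_apply, Pi.smul_apply, smul_eq_mul] at hk'
    rw [← neg_mul] at hk'
    exact (mul_right_cancel₀ hk hk').symm
  rw [h1] at h2
  have : (2 : ℂ) * Complex.I = 0 := by linear_combination h2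
  exact mul_ne_zero two_ne_zero Complex.I_ne_zero this

/-- **If `ψ` occurs in `V^{-1,0}` then `ψ̄` does not** («no two of them are complex conjugate of each other»): a
`ψ̄`-eigenvector of `V^{-1,0}` conjugates to a `ψ`-eigenvector of `V^{0,-1}`.
[cite: MilneCM2006, Ch. I §3 p. 29] [cite: Shimura1998, §5.2 pp. 39–40] -/
theorem not_occurs_conjEmb_of_occurs (h : IsCMAlgTorusRat P ρ)
    (hZ : m.range = Subalgebra.center ℚ ↥(endAlgRat P)) {ψ : Emb Z}
    (hψ : ∃ v ∈ hodgeFiltrationConj (jMatrix P), v ≠ 0 ∧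
      ∀ z, (m z : Matrix ι ι ℚ).map (algebraMap ℚ ℂ) *ᵥ v = ψ z • v) :
    ¬ ∃ w ∈ hodgeFiltrationConj (jMatrix P), w ≠ 0 ∧
      ∀ z, (m z : Matrix ι ι ℚ).map (algebraMap ℚ ℂ) *ᵥ w = (conjEmb ψ) z • w := by
  rintro ⟨w, hwm, hw0, hw⟩
  obtain ⟨v, hvm, hv0, hv⟩ := hψ
  have hsw : ∀ z, (m z : Matrix ι ι ℚ).map (algebraMap ℚ ℂ) *ᵥ star w = ψ z • star w := fun z => by
    have := mulVec_star_of_forall_center_mulVec_eq_smul hw z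
    rwa [conjEmb_conjEmb] at this
  have h0 := h.eq_zero_of_mem_hodgeFiltration_of_occurs hZ hvm hv0 hv (star_mem_hodgeFiltration_iff.2 hwm) hsw
  exact hw0 (by rw [← star_star w, h0, star_zero])

/-- **Every character of the centre, or its conjugate, occurs in `V^{-1,0}`**: `ψ` extends to some `φ : Y → ℂ` (§0); if
`φ ∈ Φ` its eigenvector of `V^{-1,0}` (FILE 1) is a `ψ`-eigenvector, otherwise `φ̄ ∈ Φ` and its eigenvector is a
`ψ̄`-eigenvector. [cite: MilneCM2006, Ch. I §3 p. 29 and §3.11] -/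
theorem occurs_or_occurs_conjEmb (h : IsCMAlgTorusRat P ρ)
    (hZ : m.range = Subalgebra.center ℚ ↥(endAlgRat P)) (hinj : Function.Injective m) (ψ : Emb Z) :
    (∃ v ∈ hodgeFiltrationConj (jMatrix P), v ≠ 0 ∧
      ∀ z, (m z : Matrix ι ι ℚ).map (algebraMap ℚ ℂ) *ᵥ v = ψ z • v) ∨
    ∃ v ∈ hodgeFiltrationConj (jMatrix P), v ≠ 0 ∧
      ∀ z, (m z : Matrix ι ι ℚ).map (algebraMap ℚ ℂ) *ᵥ v = (conjEmb ψ) z • v := by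
  obtain ⟨i, hi⟩ := h.exists_algHom_of_range_eq_center hZ
  obtain ⟨φ, rfl⟩ := exists_comp_eq hinj i hi ψ
  by_cases hφ : φ ∈ (cmTypeOnPi fun j => cmTypeEquivCMTypeOn (L j) (h.cmType j)).Φ
  · obtain ⟨v, hvm, hv0, hv⟩ := h.exists_ne_zero_mem_hodgeFiltrationConj_forall_mulVec_eq_smul hφ
    exact Or.inl ⟨v, hvm, hv0, forall_center_mulVec_eq_smul_of_forall i hi hv⟩
  · have hφ' : conjEmb φ ∈ (cmTypeOnPi fun j => cmTypeEquivCMTypeOn (L j) (h.cmType j)).Φ := by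
      by_contra hc
      exact hφ (((cmTypeOnPi fun j => cmTypeEquivCMTypeOn (L j) (h.cmType j)).mem_iff φ).2 hc)
    obtain ⟨v, hvm, hv0, hv⟩ := h.exists_ne_zero_mem_hodgeFiltrationConj_forall_mulVec_eq_smul hφ'
    exact Or.inr ⟨v, hvm, hv0, forall_center_mulVec_eq_smul_of_forall i hi hv⟩

/-! ## §3 «There exists a CM-type `Φ₀` on `E₀`»: the characters of the centre occurring in `V^{-1,0}` -/

/-- **«Let `E₀` be the centre of `End⁰(A)`. There exists a CM-type `Φ₀` on `E₀` …»** — at torus level, for `(Z, m)`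
the centre of `End_ℚ(X)`: `Z` carries a CM type `Φ₀` whose members are EXACTLY the characters `ψ : Z → ℂ` occurring
in `V^{-1,0} = Lie(X)` (§3.11's «the set of homomorphisms occurring in the representation on `Tgt₀(A)`», applied to
`E₀`): it is a CM type because `ψ` occurring excludes `ψ̄` occurring (`J ∈ E₀ ⊗ ℝ` acts by one scalar per character)
and one of `ψ`, `ψ̄` always occurs.  The characterisation mentions `X` and its centre only, not `(Y, ρ)`.
[cite: MilneCM2006, Ch. I §3 p. 29 and §3.11] [cite: Shimura1998, §5.2 pp. 39–40] -/
theorem exists_cmTypeOn_of_range_eq_center (h : IsCMAlgTorusRat P ρ)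
    (hZ : m.range = Subalgebra.center ℚ ↥(endAlgRat P)) (hinj : Function.Injective m) :
    ∃ Φ₀ : CMTypeOn Z, ∀ ψ, ψ ∈ Φ₀.Φ ↔
      ∃ v ∈ hodgeFiltrationConj (jMatrix P), v ≠ 0 ∧
        ∀ z, (m z : Matrix ι ι ℚ).map (algebraMap ℚ ℂ) *ᵥ v = ψ z • v := by
  classical
  haveI : Module.Finite ℚ Z := moduleFinite_of_injective₅₄ hinj
  let S : Finset (Emb Z) := Finset.univ.filter fun ψ =>
    ∃ v ∈ hodgeFiltrationConj (jMatrix P), v ≠ 0 ∧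
      ∀ z, (m z : Matrix ι ι ℚ).map (algebraMap ℚ ℂ) *ᵥ v = ψ z • v
  have hS : ∀ ψ, ψ ∈ S ↔ ∃ v ∈ hodgeFiltrationConj (jMatrix P), v ≠ 0 ∧
      ∀ z, (m z : Matrix ι ι ℚ).map (algebraMap ℚ ℂ) *ᵥ v = ψ z • v := fun ψ => by
    simp only [S, Finset.mem_filter, Finset.mem_univ, true_and]
  refine ⟨⟨S, fun ψ => ?_⟩, hS⟩
  rw [hS, hS]
  exact ⟨fun hψ => h.not_occurs_conjEmb_of_occurs hZ hψ,
    fun hn => (h.occurs_or_occurs_conjEmb hZ hinj ψ).resolve_right hn⟩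

omit [Fintype t] [DecidableEq t] [∀ i, NumberField (L i)] [∀ i, Field (L i)] in
/-- `Φ₀` is determined by the characterisation (two CM types of `Z` whose members are the characters occurring in
`V^{-1,0}` coincide) — in particular it does not depend on the CM-algebra structure `(Y, ρ)` used to produce it.
[cite: MilneCM2006, Ch. I §3 p. 29] -/
theorem cmTypeOn_unique_of_occurs {Φ₀ Φ₀' : CMTypeOn Z}
    (hΦ₀ : ∀ ψ, ψ ∈ Φ₀.Φ ↔ ∃ v ∈ hodgeFiltrationConj (jMatrix P), v ≠ 0 ∧
      ∀ z, (m z : Matrix ι ι ℚ).map (algebraMap ℚ ℂ) *ᵥ v = ψ z • v)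
    (hΦ₀' : ∀ ψ, ψ ∈ Φ₀'.Φ ↔ ∃ v ∈ hodgeFiltrationConj (jMatrix P), v ≠ 0 ∧
      ∀ z, (m z : Matrix ι ι ℚ).map (algebraMap ℚ ℂ) *ᵥ v = ψ z • v) : Φ₀ = Φ₀' :=
  CMTypeOn.ext' (Finset.ext fun ψ => (hΦ₀ ψ).trans (hΦ₀' ψ).symm)

/-! ## §4 «then `(E, Φ)` extends `(E₀, Φ₀)`» -/

/-- **«suppose `A` is of CM-type `(E, Φ)` (relative to `E → End⁰(A)`); then `(E, Φ)` extends `(E₀, Φ₀)`»** — at torus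
level: the CM type `Φ = ⊔ᵢ Φᵢ` of `(X, ρ)` is the EXTENSION along `i : E₀ → Y` of the CM type `Φ₀` of the centre
(`cmTypeOnExtend i Φ₀ = {φ | φ ∘ i ∈ Φ₀}`): for `φ ∈ Φ` the `φ`-eigenvector of `V^{-1,0}` (FILE 1) is a
`φ|E₀`-eigenvector, so `φ|E₀ ∈ Φ₀`, and a CM type whose restrictions lie in `Φ₀` is `Φ₀^Y`
(`eq_cmTypeOnExtend_of_restrictSet_subset`). [cite: MilneCM2006, Ch. I §3 p. 29 and §1 p. 11 (after Def. 1.8)] -/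
theorem cmTypeOnPi_eq_cmTypeOnExtend (h : IsCMAlgTorusRat P ρ) (i : Z →ₐ[ℚ] (Π j, L j))
    (hi : ∀ z, ρ (i z) = (m z : Matrix ι ι ℚ)) {Φ₀ : CMTypeOn Z}
    (hΦ₀ : ∀ ψ, ψ ∈ Φ₀.Φ ↔ ∃ v ∈ hodgeFiltrationConj (jMatrix P), v ≠ 0 ∧
      ∀ z, (m z : Matrix ι ι ℚ).map (algebraMap ℚ ℂ) *ᵥ v = ψ z • v) :
    (cmTypeOnPi fun j => cmTypeEquivCMTypeOn (L j) (h.cmType j)) = cmTypeOnExtend i Φ₀ := by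
  refine eq_cmTypeOnExtend_of_restrictSet_subset i _ Φ₀ fun ψ hψ => ?_
  obtain ⟨φ, hφ, hφψ⟩ := (mem_cmTypeOnRestrictSet_iff i _ ψ).1 hψ
  obtain ⟨v, hvm, hv0, hv⟩ := h.exists_ne_zero_mem_hodgeFiltrationConj_forall_mulVec_eq_smul hφ
  rw [← hφψ]
  exact (hΦ₀ _).2 ⟨v, hvm, hv0, forall_center_mulVec_eq_smul_of_forall i hi hv⟩

/-- Membership form: **`φ ∈ Φ ⟺ φ|E₀ ∈ Φ₀`** for every `φ : Y → ℂ`. [cite: MilneCM2006, Ch. I §3 p. 29 and §1 p. 11] -/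
theorem mem_cmType_iff_comp_mem (h : IsCMAlgTorusRat P ρ) (i : Z →ₐ[ℚ] (Π j, L j))
    (hi : ∀ z, ρ (i z) = (m z : Matrix ι ι ℚ)) {Φ₀ : CMTypeOn Z}
    (hΦ₀ : ∀ ψ, ψ ∈ Φ₀.Φ ↔ ∃ v ∈ hodgeFiltrationConj (jMatrix P), v ≠ 0 ∧
      ∀ z, (m z : Matrix ι ι ℚ).map (algebraMap ℚ ℂ) *ᵥ v = ψ z • v) (φ : Emb (Π j, L j)) :
    φ ∈ (cmTypeOnPi fun j => cmTypeEquivCMTypeOn (L j) (h.cmType j)).Φ ↔ φ.comp i ∈ Φ₀.Φ := by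
  rw [h.cmTypeOnPi_eq_cmTypeOnExtend i hi hΦ₀, mem_cmTypeOnExtend_iff]

/-! ## §5 «Therefore, the reflex field of `(E₀, Φ₀)` equals the reflex field of any such `(E, Φ)` (1.18c)» -/

/-- **«the reflex field of `(E₀, Φ₀)` equals the reflex field of any such `(E, Φ)` (1.18c)»** — at torus level:
`E* = reflexFieldOn Φ = reflexFieldOn Φ₀` for the CM type `Φ₀` of the centre `(Z, m)` (Prop. 1.18 (c), the tree's
`reflexFieldOn_cmTypeOnExtend`, whose surjectivity hypothesis is §1's `exists_comp_eq`).
[cite: MilneCM2006, Ch. I §3 p. 29 and §1 Prop. 1.18 (c)] -/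
theorem reflexFieldOn_eq_reflexFieldOn_of_range_eq_center (h : IsCMAlgTorusRat P ρ)
    (hZ : m.range = Subalgebra.center ℚ ↥(endAlgRat P)) (hinj : Function.Injective m) {Φ₀ : CMTypeOn Z}
    (hΦ₀ : ∀ ψ, ψ ∈ Φ₀.Φ ↔ ∃ v ∈ hodgeFiltrationConj (jMatrix P), v ≠ 0 ∧
      ∀ z, (m z : Matrix ι ι ℚ).map (algebraMap ℚ ℂ) *ᵥ v = ψ z • v) :
    reflexFieldOn (cmTypeOnPi fun j => cmTypeEquivCMTypeOn (L j) (h.cmType j)) = reflexFieldOn Φ₀ := by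
  haveI : Module.Finite ℚ Z := moduleFinite_of_injective₅₄ hinj
  obtain ⟨i, hi⟩ := h.exists_algHom_of_range_eq_center hZ
  rw [h.cmTypeOnPi_eq_cmTypeOnExtend i hi hΦ₀]
  exact reflexFieldOn_cmTypeOnExtend i (fun ψ => exists_comp_eq hinj i hi ψ) Φ₀

/-- With FILE 1: **the reflex field of the centre's CM type is `ℚ(entries of i·J_ℂ)`** — the reflex field of `X`.
[cite: MilneCM2006, Ch. I §3 p. 29 and §4 Prop. 4.26 (a)] -/
theorem reflexFieldOn_eq_adjoin_entries_of_range_eq_center (h : IsCMAlgTorusRat P ρ)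
    (hZ : m.range = Subalgebra.center ℚ ↥(endAlgRat P)) (hinj : Function.Injective m) {Φ₀ : CMTypeOn Z}
    (hΦ₀ : ∀ ψ, ψ ∈ Φ₀.Φ ↔ ∃ v ∈ hodgeFiltrationConj (jMatrix P), v ≠ 0 ∧
      ∀ z, (m z : Matrix ι ι ℚ).map (algebraMap ℚ ℂ) *ᵥ v = ψ z • v) :
    reflexFieldOn Φ₀ =
      IntermediateField.adjoin ℚ (Set.range fun kl : ι × ι => Complex.I * ((jMatrix P kl.1 kl.2 : ℝ) : ℂ)) := by
  rw [← h.reflexFieldOn_eq_reflexFieldOn_of_range_eq_center hZ hinj hΦ₀, h.reflexFieldOn_eq_adjoin_entries]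

/-! ## §6 `E₀ = Subalgebra.center ℚ (endAlgRat P)` itself -/

/-- §1 for the centre itself: `E₀ = Z(End_ℚ(X))` embeds in `Y` with `ρ ∘ i` the inclusion.
[cite: MilneCM2006, Ch. I §3 p. 29] -/
theorem exists_algHom_center (h : IsCMAlgTorusRat P ρ) :
    ∃ i : ↥(Subalgebra.center ℚ ↥(endAlgRat P)) →ₐ[ℚ] (Π j, L j),
      ∀ z, ρ (i z) = ((z : endAlgRat P) : Matrix ι ι ℚ) :=
  h.exists_algHom_of_range_eq_center (Z := ↥(Subalgebra.center ℚ ↥(endAlgRat P)))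
    (m := (Subalgebra.center ℚ ↥(endAlgRat P)).val) (Subalgebra.range_val _)

/-- **«Let `E₀` be the centre of `End⁰(A)`. There exists a CM-type `Φ₀` on `E₀`»**, verbatim carrier: the centre
`Subalgebra.center ℚ (endAlgRat P)` of `End_ℚ(X)` carries a CM type whose members are exactly the characters of the
centre occurring in `V^{-1,0}`. [cite: MilneCM2006, Ch. I §3 p. 29 and §3.11] -/
theorem exists_cmTypeOn_center (h : IsCMAlgTorusRat P ρ) :
    ∃ Φ₀ : CMTypeOn ↥(Subalgebra.center ℚ ↥(endAlgRat P)), ∀ ψ, ψ ∈ Φ₀.Φ ↔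
      ∃ v ∈ hodgeFiltrationConj (jMatrix P), v ≠ 0 ∧
        ∀ z : ↥(Subalgebra.center ℚ ↥(endAlgRat P)),
          ((z : endAlgRat P) : Matrix ι ι ℚ).map (algebraMap ℚ ℂ) *ᵥ v = ψ z • v := by
  -- (elaborated in steps: the centre's inclusion is fed at the generic carrier first, then `val z = z`)
  obtain ⟨Φ₀, hΦ₀⟩ := h.exists_cmTypeOn_of_range_eq_center (Z := ↥(Subalgebra.center ℚ ↥(endAlgRat P)))
    (m := (Subalgebra.center ℚ ↥(endAlgRat P)).val) (Subalgebra.range_val _) Subtype.val_injective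
  refine ⟨Φ₀, fun ψ => ?_⟩
  rw [hΦ₀]
  rfl

/-- **«Therefore, the reflex field of `(E₀, Φ₀)` equals the reflex field of any such `(E, Φ)` (1.18c). We call it the
reflex field of `A`»**, verbatim carrier: for the CM type `Φ₀` of the centre `Subalgebra.center ℚ (endAlgRat P)`
(characterised by occurrence in `V^{-1,0}`), `reflexFieldOn Φ = reflexFieldOn Φ₀` for EVERY CM-algebra structure
`(Y, ρ)` on `X`. [cite: MilneCM2006, Ch. I §3 p. 29 and §1 Prop. 1.18 (c)] -/
theorem reflexFieldOn_eq_reflexFieldOn_center (h : IsCMAlgTorusRat P ρ)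
    {Φ₀ : CMTypeOn ↥(Subalgebra.center ℚ ↥(endAlgRat P))}
    (hΦ₀ : ∀ ψ, ψ ∈ Φ₀.Φ ↔ ∃ v ∈ hodgeFiltrationConj (jMatrix P), v ≠ 0 ∧
      ∀ z : ↥(Subalgebra.center ℚ ↥(endAlgRat P)),
        ((z : endAlgRat P) : Matrix ι ι ℚ).map (algebraMap ℚ ℂ) *ᵥ v = ψ z • v) :
    reflexFieldOn (cmTypeOnPi fun j => cmTypeEquivCMTypeOn (L j) (h.cmType j)) = reflexFieldOn Φ₀ := by
  have key := h.reflexFieldOn_eq_reflexFieldOn_of_range_eq_center (Z := ↥(Subalgebra.center ℚ ↥(endAlgRat P)))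
    (m := (Subalgebra.center ℚ ↥(endAlgRat P)).val) (Subalgebra.range_val _) Subtype.val_injective (Φ₀ := Φ₀)
    (fun ψ => by rw [hΦ₀]; rfl)
  exact key

/-- With FILE 1, verbatim carrier: **the reflex field of `X` read on the centre is `ℚ(entries of i·J_ℂ)`**.
[cite: MilneCM2006, Ch. I §3 p. 29 and §4 Prop. 4.26 (a)] -/
theorem reflexFieldOn_center_eq_adjoin_entries (h : IsCMAlgTorusRat P ρ)
    {Φ₀ : CMTypeOn ↥(Subalgebra.center ℚ ↥(endAlgRat P))}
    (hΦ₀ : ∀ ψ, ψ ∈ Φ₀.Φ ↔ ∃ v ∈ hodgeFiltrationConj (jMatrix P), v ≠ 0 ∧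
      ∀ z : ↥(Subalgebra.center ℚ ↥(endAlgRat P)),
        ((z : endAlgRat P) : Matrix ι ι ℚ).map (algebraMap ℚ ℂ) *ᵥ v = ψ z • v) :
    reflexFieldOn Φ₀ =
      IntermediateField.adjoin ℚ (Set.range fun kl : ι × ι => Complex.I * ((jMatrix P kl.1 kl.2 : ℝ) : ℂ)) := by
  rw [← h.reflexFieldOn_eq_reflexFieldOn_center hΦ₀, h.reflexFieldOn_eq_adjoin_entries]

/-! ## §7 «let `Φ` be the set of homomorphisms `E → ℂ` occurring in the representation of `E` on `Tgt₀(A)`» (§3.11);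
## the case `E₀ = E` -/

/-- **§3.11, verbatim: «let `Φ` be the set of homomorphisms `E → ℂ` occurring in the representation of `E` on
`Tgt₀(A)`, i.e., `Tgt₀(A) ≅ ⊕_{φ∈Φ} ℂ_φ`»** — at torus level: `φ ∈ Φ = ⊔ᵢ Φᵢ` iff some non-zero `v ∈ V^{-1,0} = Lie(X)`
is a joint `φ`-eigenvector of `ρ(Y) ⊗ 1` (FILE 1: members occur, non-members have no eigenvector in `V^{-1,0}`).
[cite: MilneCM2006, Ch. I §3.11 p. 29] -/
theorem mem_cmTypeOnPi_iff_occurs (h : IsCMAlgTorusRat P ρ) (φ : Emb (Π j, L j)) :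
    φ ∈ (cmTypeOnPi fun j => cmTypeEquivCMTypeOn (L j) (h.cmType j)).Φ ↔
      ∃ v ∈ hodgeFiltrationConj (jMatrix P), v ≠ 0 ∧ ∀ a, (ρ a).map (algebraMap ℚ ℂ) *ᵥ v = φ a • v :=
  ⟨fun hφ => h.exists_ne_zero_mem_hodgeFiltrationConj_forall_mulVec_eq_smul hφ, fun ⟨_, hvm, hv0, hv⟩ =>
    by_contra fun hφ => hv0 (h.eq_zero_of_mem_hodgeFiltrationConj_of_not_mem hφ hvm hv)⟩

/-- Hence **a CM type of `Y` whose members are the characters occurring in `V^{-1,0}` (through `ρ`, i.e. through the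
model `(Y, h.toEnd)`) IS `Φ`** — §3's `Φ₀` for `(Z, m) = (Y, ρ)`. [cite: MilneCM2006, Ch. I §3.11 p. 29] -/
theorem eq_cmTypeOnPi_of_occurs (h : IsCMAlgTorusRat P ρ) {Φ₀ : CMTypeOn (Π j, L j)}
    (hΦ₀ : ∀ φ, φ ∈ Φ₀.Φ ↔ ∃ v ∈ hodgeFiltrationConj (jMatrix P), v ≠ 0 ∧
      ∀ a, ((h.toEnd a : endAlgRat P) : Matrix ι ι ℚ).map (algebraMap ℚ ℂ) *ᵥ v = φ a • v) :
    Φ₀ = cmTypeOnPi fun j => cmTypeEquivCMTypeOn (L j) (h.cmType j) :=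
  CMTypeOn.ext' (Finset.ext fun φ => by simp only [hΦ₀, h.mem_cmTypeOnPi_iff_occurs, coe_toEnd_apply])

/-- **The case `E₀ = E`**: when `End_ℚ(X)` is COMMUTATIVE (Remark 3.5 / Prop. 3.6 (a): e.g. `X` simple with complex
multiplication, `End⁰(X)` a CM field of degree `2 dim X`), `ρ(Y)` is the centre of `End_ℚ(X)` — `(Y, ρ)` is a centre
model `(Z, m)` in the sense of §§1–5 (`m = h.toEnd`), so `Φ₀ = Φ` (`eq_cmTypeOnPi_of_occurs`) and `E₀* = E*`.  (`ρ(Y)` is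
its own commutant in `End_ℚ(X)`, `mem_range_of_forall_comm`.) [cite: MilneCM2006, Ch. I §3 Remark 3.5, Prop. 3.6 (a), p. 28–29] -/
theorem range_toEnd_eq_center (h : IsCMAlgTorusRat P ρ)
    (hcomm : ∀ M ∈ endAlgRat P, ∀ N ∈ endAlgRat P, M * N = N * M) :
    h.toEnd.range = Subalgebra.center ℚ ↥(endAlgRat P) := by
  ext x
  rw [Subalgebra.mem_center_iff]
  constructor
  · intro hx b
    obtain ⟨a, rfl⟩ := (AlgHom.mem_range h.toEnd).1 hx
    apply Subtype.ext
    rw [Subalgebra.coe_mul, Subalgebra.coe_mul, coe_toEnd_apply]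
    exact hcomm _ b.2 _ (h.mem_endAlgRat a)
  · intro _
    obtain ⟨a, ha⟩ := (AlgHom.mem_range ρ).1 (h.mem_range_of_forall_comm fun N hN => hcomm _ x.2 N hN)
    exact (AlgHom.mem_range h.toEnd).2 ⟨a, Subtype.ext (by rw [coe_toEnd_apply, ha])⟩

end IsCMAlgTorusRat

end Literature.NumberTheory.ComplexMultiplication
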